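import Mathlib
import Summits.Ventures.HodgeRepro.Tier4.Line1.SpectralRegroup
import Summits.Ventures.HodgeRepro.Tier4.Line1.SpectralOfRTF

/-!
# Tier4/Line1/HeckeFiniteness — HECKE FINITENESS AS A THEOREM: a left-`K`-invariant test function meets only
finitely many blocks of the spectral expansion

Blind re-derivation cell `pub-hodge-repro`, Tier 4 (README §9–§10), seat t4-L1-p1 (gen 3).  Target tree path
`lean/Summits/Ventures/HodgeRepro/Tier4/Line1/HeckeFiniteness.lean`.  Imports t4-L1-p5's `SpectralRegroup`
(`integrableOn_mul_conj_of_continuous`) and this seat's `SpectralOfRTF` (`specTerm`, `specBlock`,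
`exists_specTerm_ne_zero_of_specBlock_ne_zero`).

WHAT THIS IS.  Plan-1's cut (8) (S13498) displays, inside the identification (S1′), the clause «the test pair of a
Hecke choice meets only the blocks of its finite spectrum» (`FiniteSpectrum`, (S1b)) as an INPUT.  This file proves it
on every `RTF.Setting G`, for test functions of a LEVEL: if `K ≤ G` is an OPEN subgroup and `f₁` is left-`K`-invariant,
then `{m | specBlock S χ χ' φ n f₁ f₂ m ≠ 0}` is FINITE (`finite_specBlock_support`), so some `Finset` carries every
non-zero block (`exists_finset_specBlock_support`).  Night-2's residual (c), «the finite spectrum at a level», in its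
kernel form.  The proof: (1) `R (f̄₁) φ_j` is right-`K`-invariant (`R_mul_right_of_left_invariant`: the substitution
`g ↦ k⁻¹ g` and the left invariance of the Haar measure) and lies in `τ (n j)`, so a non-zero `m`-block puts a NON-ZERO
continuous, left-`Gk`- and right-`K`-invariant function into `τ m` (`exists_biinvariant_of_specBlock_ne_zero`);
(2) `Gk\G/K` is finite (`exists_finset_doubleCoset_cover`: `K` open ⇒ `xK` has positive Haar measure ⇒ it meets the
full-measure set covered by the translates of `DG` (`fdG.ae_covers`), so `G = Gk · closure DG · K`, and the compact
`closure DG` is covered by finitely many open cosets); (3) a bi-invariant function is determined by its values on the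
finitely many representatives (`eq_zero_of_forall_rep`); (4) functions of distinct `τ m` are `S.inner`-orthogonal
(`IsAdaptedONB.orthSub`) and a non-zero continuous `Gk`-invariant function has `S.inner ψ ψ ≠ 0`
(`inner_self_ne_zero_of_invariant`: `∫_{DG} |ψ|² = 0` ⇒ `ψ = 0` a.e. on `DG` ⇒ a.e. on `G` by invariance and the a.e.
covering ⇒ everywhere by continuity, the Haar measure being positive on opens), so the chosen functions are linearly
independent in the space of functions on the representatives (`linearIndependent_eval`), whence at most `|Gk\G/K|`
indices `m`.  Every step is over the generic setting; `[Countable S.Gk]` as in t4-L1-p4's `CentralVanishing`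
(the adelic instance has it, `rationalPoints_countable`).  0 print.  NOT claimed: anything about the seesaw identity
(S1a), the isolation (S3), or `P_T4`.  Nothing here says anything about the status of the Hodge conjecture for CM
abelian varieties, which is NOT proved (HC_CM is NOT proved by anyone in this repository).
-/

set_option autoImplicit false

noncomputable section

namespace Summit.Ventures.HodgeRepro.Tier4.Line1

open MeasureTheory Topology
open scoped Pointwise

namespace RTF

namespace Setting

variable {G : Type} [Group G] [TopologicalSpace G] [IsTopologicalGroup G] [MeasurableSpace G] [BorelSpace G]
  (S : Setting G)

section Invariance

omit [IsTopologicalGroup G] [BorelSpace G] in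
/-- **right-`K`-invariance of `R f ψ`** for a left-`K`-invariant `f`: the substitution `g ↦ k⁻¹ g` in `R` and the left
invariance of the Haar measure. -/
theorem R_mul_right_of_left_invariant [MeasurableMul G] (K : Subgroup G) {f : G → ℂ}
    (hf : ∀ k ∈ K, ∀ g, f (k * g) = f g) (ψ : G → ℂ) {k : G} (hk : k ∈ K) (x : G) :
    S.R f ψ (x * k) = S.R f ψ x := by
  haveI := S.haar
  unfold R
  have h := integral_mul_left_eq_self (μ := S.μ) (fun g => f g * ψ (x * g)) k
  rw [← h]
  refine integral_congr_ae (Filter.Eventually.of_forall fun g => ?_)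
  simp only
  rw [hf k hk g, mul_assoc]

omit [TopologicalSpace G] [IsTopologicalGroup G] [MeasurableSpace G] [BorelSpace G] in
/-- the conjugate of a left-`K`-invariant function is left-`K`-invariant. -/
theorem cj_left_invariant (K : Subgroup G) {f : G → ℂ} (hf : ∀ k ∈ K, ∀ g, f (k * g) = f g) :
    ∀ k ∈ K, ∀ g, cj f (k * g) = cj f g := by
  intro k hk g
  unfold cj
  rw [hf k hk g]

omit [IsTopologicalGroup G] [BorelSpace G] in
/-- a finite linear combination of `Gk`-invariant functions is `Gk`-invariant. -/
theorem invariant_finset_sum {ι : Type} (F : Finset ι) (c : ι → ℂ) (ψ : ι → G → ℂ)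
    (h : ∀ i ∈ F, S.Invariant (ψ i)) : S.Invariant fun x => ∑ i ∈ F, c i * ψ i x := by
  intro γ x
  simp only
  refine Finset.sum_congr rfl fun i hi => ?_
  rw [h i hi γ x]

end Invariance

section Cover

omit [BorelSpace G] in
/-- **`Gk\G/K` is finite** for an open subgroup `K` of the setting's group: finitely many `g ∈ s` with
`G = ⋃_{g ∈ s} Gk · g · K`. -/
theorem exists_finset_doubleCoset_cover (K : Subgroup G) (hK : IsOpen (K : Set G)) :
    ∃ s : Finset G, ∀ x : G, ∃ g ∈ s, ∃ γ : S.Gk, ∃ k ∈ K, x = (γ : G) * g * k := by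
  haveI := S.haar
  -- the open cosets `g • K` cover the compact `closure DG`
  have hcover : closure S.DG ⊆ ⋃ g : G, g • (K : Set G) := by
    intro y _
    refine Set.mem_iUnion.mpr ⟨y, ?_⟩
    exact ⟨1, K.one_mem, by simp⟩
  obtain ⟨s, hs⟩ := S.compG.elim_finite_subcover (fun g : G => g • (K : Set G)) (fun g => hK.leftCoset g) hcover
  refine ⟨s, fun x => ?_⟩
  -- `x • K` has positive measure, so it meets the full-measure set covered by the translates of `DG`
  have hpos : 0 < S.μ (x • (K : Set G)) :=
    (hK.leftCoset x).measure_pos S.μ ⟨x, 1, K.one_mem, by simp⟩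
  have hae : ∀ᵐ y ∂S.μ, ∃ γ : S.Gk, γ • y ∈ S.DG := S.fdG.ae_covers
  have hmeet : ∃ y ∈ x • (K : Set G), ∃ γ : S.Gk, γ • y ∈ S.DG := by
    by_contra hcon
    push Not at hcon
    have hsub : x • (K : Set G) ⊆ {y | ¬ ∃ γ : S.Gk, γ • y ∈ S.DG} := by
      intro y hy
      simp only [Set.mem_setOf_eq, not_exists]
      exact hcon y hy
    have h0 : S.μ {y | ¬ ∃ γ : S.Gk, γ • y ∈ S.DG} = 0 := ae_iff.mp hae
    exact absurd (measure_mono_null hsub h0) hpos.ne'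
  obtain ⟨y, hy, γ, hγ⟩ := hmeet
  obtain ⟨k, hk, rfl⟩ := hy
  have hmem : γ • (x • k) ∈ ⋃ g ∈ s, g • (K : Set G) := hs (subset_closure hγ)
  obtain ⟨g, hg, k', hk', hgk⟩ := Set.mem_iUnion₂.mp hmem
  refine ⟨g, hg, γ⁻¹, k' * k⁻¹, K.mul_mem hk' (K.inv_mem hk), ?_⟩
  simp only [smul_eq_mul, Subgroup.smul_def] at hgk
  have hγ' : ((γ⁻¹ : S.Gk) : G) = ((γ : S.Gk) : G)⁻¹ := rfl
  rw [hγ']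
  calc x = ((γ : S.Gk) : G)⁻¹ * (((γ : S.Gk) : G) * (x * k)) * k⁻¹ := by group
    _ = ((γ : S.Gk) : G)⁻¹ * (g * k') * k⁻¹ := by rw [← hgk]
    _ = ((γ : S.Gk) : G)⁻¹ * g * (k' * k⁻¹) := by group

omit [IsTopologicalGroup G] [BorelSpace G] in
/-- a left-`Gk`- and right-`K`-invariant function vanishing on the representatives vanishes. -/
theorem eq_zero_of_forall_rep (K : Subgroup G) {s : Finset G}
    (hs : ∀ x : G, ∃ g ∈ s, ∃ γ : S.Gk, ∃ k ∈ K, x = (γ : G) * g * k) {ψ : G → ℂ} (hinv : S.Invariant ψ)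
    (hKinv : ∀ k ∈ K, ∀ x, ψ (x * k) = ψ x) (h0 : ∀ g ∈ s, ψ g = 0) : ψ = 0 := by
  funext x
  obtain ⟨g, hg, γ, k, hk, rfl⟩ := hs x
  rw [hKinv k hk, hinv γ g, h0 g hg]
  rfl

end Cover

section Positivity

omit [IsTopologicalGroup G] in
/-- the pairing is linear in the first argument on finite sums of continuous functions. -/
theorem inner_finset_sum_left {ι : Type} (ψ₀ : G → ℂ) (hψ₀ : Continuous ψ₀) (F : Finset ι) (c : ι → ℂ)
    (φ : ι → G → ℂ) (hφ : ∀ i ∈ F, Continuous (φ i)) :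
    S.inner (fun x => ∑ i ∈ F, c i * φ i x) ψ₀ = ∑ i ∈ F, c i * S.inner (φ i) ψ₀ := by
  haveI := S.haar
  unfold inner
  have h1 : ∀ x, (∑ i ∈ F, c i * φ i x) * starRingEnd ℂ (ψ₀ x) =
      ∑ i ∈ F, c i * (φ i x * starRingEnd ℂ (ψ₀ x)) := by
    intro x
    rw [Finset.sum_mul]
    refine Finset.sum_congr rfl fun i _ => ?_
    ring
  simp_rw [h1]
  rw [integral_finsetSum]
  · refine Finset.sum_congr rfl fun i _ => ?_
    rw [integral_const_mul]
  · intro i hi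
    exact (integrableOn_mul_conj_of_continuous S.μ S.compG (hφ i hi) hψ₀).const_mul _

omit [IsTopologicalGroup G] [BorelSpace G] in
/-- the pairing of the zero function with anything is zero. -/
theorem inner_zero_left (ψ : G → ℂ) : S.inner (0 : G → ℂ) ψ = 0 := by
  unfold inner
  simp

omit [IsTopologicalGroup G] in
/-- **positivity**: a non-zero continuous `Gk`-invariant function has a non-zero self-pairing over `DG`
(`∫_{DG} |ψ|² = 0` forces `ψ = 0` a.e. on `DG`, hence a.e. on `G` by the invariance and the a.e. covering, hence
everywhere by continuity, the Haar measure being positive on open sets). -/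
theorem inner_self_ne_zero_of_invariant [Countable S.Gk] [MeasurableMul G] {ψ : G → ℂ} (hψ : Continuous ψ)
    (hinv : S.Invariant ψ) (hne : ψ ≠ 0) : S.inner ψ ψ ≠ 0 := by
  haveI := S.haar
  intro h0
  apply hne
  -- the self-pairing is the integral of `normSq ∘ ψ`
  have hreal : S.inner ψ ψ = ((∫ x in S.DG, Complex.normSq (ψ x) ∂S.μ : ℝ) : ℂ) := by
    unfold inner
    simp_rw [Complex.mul_conj]
    exact integral_ofReal
  have hint : IntegrableOn (fun x => Complex.normSq (ψ x)) S.DG S.μ := by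
    have h : IntegrableOn (fun x => Complex.normSq (ψ x)) (closure S.DG) S.μ :=
      (Complex.continuous_normSq.comp hψ).continuousOn.integrableOn_compact' S.compG
        isClosed_closure.measurableSet
    exact h.mono_set subset_closure
  have hzero : ∫ x in S.DG, Complex.normSq (ψ x) ∂S.μ = 0 := by
    rw [hreal] at h0
    exact_mod_cast h0
  have hae : (fun x => Complex.normSq (ψ x)) =ᵐ[S.μ.restrict S.DG] 0 :=
    (integral_eq_zero_iff_of_nonneg (fun x => Complex.normSq_nonneg (ψ x)) hint).mp hzero
  -- hence `ψ = 0` a.e. on `DG`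
  have hDG : ∀ᵐ x ∂S.μ, x ∈ S.DG → ψ x = 0 := by
    have h := (ae_restrict_iff'₀ S.fdG.nullMeasurableSet).mp hae
    filter_upwards [h] with x hx hxD
    exact Complex.normSq_eq_zero.mp (hx hxD)
  -- transported along every rational translate
  have hall : ∀ᵐ x ∂S.μ, ∀ γ : S.Gk, (γ : G) * x ∈ S.DG → ψ ((γ : G) * x) = 0 := by
    rw [ae_all_iff]
    intro γ
    exact (measurePreserving_mul_left S.μ (γ : G)).quasiMeasurePreserving.ae hDG
  -- so `ψ = 0` a.e. on `G`
  have hG : ψ =ᵐ[S.μ] 0 := by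
    filter_upwards [hall, S.fdG.ae_covers] with x hx hcov
    obtain ⟨γ, hγ⟩ := hcov
    have hγ' : (γ : G) * x ∈ S.DG := hγ
    rw [← hinv γ x]
    exact hx γ hγ'
  exact (hψ.ae_eq_iff_eq S.μ continuous_zero).mp hG

end Positivity

section Counting

omit [IsTopologicalGroup G] in
/-- **linear independence of the evaluations**: non-zero continuous bi-invariant functions taken from distinct
invariant subspaces of an adapted family are linearly independent as functions on the representatives. -/
theorem linearIndependent_eval [Countable S.Gk] [MeasurableMul G] (K : Subgroup G) {s : Finset G}
    (hs : ∀ x : G, ∃ g ∈ s, ∃ γ : S.Gk, ∃ k ∈ K, x = (γ : G) * g * k) {τ : ℕ → Set (G → ℂ)}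
    {φ : ℕ → G → ℂ} {n : ℕ → ℕ} (hB : S.IsAdaptedONB τ φ n) {ι : Type} (idx : ι → ℕ)
    (hidx : Function.Injective idx) (ψ : ι → G → ℂ) (hmem : ∀ i, ψ i ∈ τ (idx i)) (hne : ∀ i, ψ i ≠ 0)
    (hKinv : ∀ i, ∀ k ∈ K, ∀ x, ψ i (x * k) = ψ i x) :
    LinearIndependent ℂ fun i : ι => fun g : s => ψ i g := by
  have hcont : ∀ i, Continuous (ψ i) := fun i => (hB.inv (idx i)).cont _ (hmem i)
  have hinv : ∀ i, S.Invariant (ψ i) := fun i => (hB.inv (idx i)).inv _ (hmem i)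
  rw [linearIndependent_iff']
  intro t c hsum i₀ hi₀
  -- the combination vanishes on the representatives, hence everywhere
  set Ψ : G → ℂ := fun x => ∑ i ∈ t, c i * ψ i x with hΨ
  have hΨ0 : Ψ = 0 := by
    refine S.eq_zero_of_forall_rep K hs (S.invariant_finset_sum t c ψ fun i _ => hinv i) ?_ ?_
    · intro k hk x
      simp only [hΨ]
      refine Finset.sum_congr rfl fun i _ => ?_
      rw [hKinv i k hk x]
    · intro g hg
      have h := congrFun hsum ⟨g, hg⟩
      simp only [Finset.sum_apply, Pi.smul_apply, smul_eq_mul, Pi.zero_apply] at h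
      exact h
  -- pair with `ψ i₀`: orthogonality kills every other term
  have hpair : S.inner Ψ (ψ i₀) = c i₀ * S.inner (ψ i₀) (ψ i₀) := by
    rw [hΨ, S.inner_finset_sum_left (ψ i₀) (hcont i₀) t c ψ fun i _ => hcont i]
    rw [Finset.sum_eq_single i₀]
    · intro i _ hi
      have hidx' : idx i ≠ idx i₀ := fun h => hi (hidx h)
      rw [hB.orthSub (idx i) (idx i₀) hidx' (ψ i) (hmem i) (ψ i₀) (hmem i₀), mul_zero]
    · intro h
      exact absurd hi₀ h
  rw [hΨ0, S.inner_zero_left] at hpair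
  have hself := S.inner_self_ne_zero_of_invariant (hcont i₀) (hinv i₀) (hne i₀)
  exact (mul_eq_zero.mp hpair.symm).resolve_right hself

/-- **at most `|Gk\G/K|` invariant subspaces carry a non-zero bi-invariant function.** -/
theorem finite_biinvariant_support [Countable S.Gk] [MeasurableMul G] (K : Subgroup G) (hK : IsOpen (K : Set G))
    {τ : ℕ → Set (G → ℂ)} {φ : ℕ → G → ℂ} {n : ℕ → ℕ} (hB : S.IsAdaptedONB τ φ n) :
    {m : ℕ | ∃ ψ ∈ τ m, ψ ≠ 0 ∧ ∀ k ∈ K, ∀ x, ψ (x * k) = ψ x}.Finite := by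
  obtain ⟨s, hs⟩ := S.exists_finset_doubleCoset_cover K hK
  by_contra hinf
  obtain ⟨M, hMsub, hMcard⟩ := (Set.not_finite.mp hinf).exists_subset_card_eq (s.card + 1)
  have hchoice : ∀ m : M, ∃ ψ : G → ℂ, ψ ∈ τ m ∧ ψ ≠ 0 ∧ ∀ k ∈ K, ∀ x, ψ (x * k) = ψ x :=
    fun m => hMsub m.2
  choose ψ hψ using hchoice
  have hli := S.linearIndependent_eval K hs hB (fun m : M => (m : ℕ)) Subtype.val_injective ψ
    (fun m => (hψ m).1) (fun m => (hψ m).2.1) (fun m => (hψ m).2.2)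
  have hcard := hli.fintype_card_le_finrank
  rw [Module.finrank_fintype_fun_eq_card, Fintype.card_coe, Fintype.card_coe, hMcard] at hcard
  omega

end Counting

section Main

variable (χ : S.T → ℂ) (χ' : S.T' → ℂ) (φ : ℕ → G → ℂ) (n : ℕ → ℕ) (f₁ f₂ : G → ℂ)

omit [IsTopologicalGroup G] [BorelSpace G] in
/-- a non-zero `m`-block of a left-`K`-invariant `f₁` puts a non-zero right-`K`-invariant function into `τ m`
(namely `R (f̄₁) φ_j` for a term of the block). -/
theorem exists_biinvariant_of_specBlock_ne_zero [MeasurableMul G] (K : Subgroup G) {τ : ℕ → Set (G → ℂ)}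
    (hB : S.IsAdaptedONB τ φ n) (h₁ : IsTest f₁) (hf₁ : ∀ k ∈ K, ∀ g, f₁ (k * g) = f₁ g) {m : ℕ}
    (h : specBlock S χ χ' φ n f₁ f₂ m ≠ 0) : ∃ ψ ∈ τ m, ψ ≠ 0 ∧ ∀ k ∈ K, ∀ x, ψ (x * k) = ψ x := by
  obtain ⟨j, hj, hne⟩ := S.exists_specTerm_ne_zero_of_specBlock_ne_zero χ χ' φ n f₁ f₂ h
  have hP : S.periodT χ (fun t => S.R (cj f₁) (φ j) t) ≠ 0 := by
    intro h0
    apply hne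
    unfold specTerm
    rw [h0]
    simp
  have hR : S.R (cj f₁) (φ j) ≠ 0 := by
    intro h0
    apply hP
    unfold periodT
    simp [h0]
  refine ⟨S.R (cj f₁) (φ j), ?_, hR, ?_⟩
  · rw [← hj]
    exact (hB.inv (n j)).conv (φ j) (hB.mem j) (cj f₁) h₁.cj
  · intro k hk x
    exact S.R_mul_right_of_left_invariant K (cj_left_invariant K hf₁) (φ j) hk x

/-- **HECKE FINITENESS** (the theorem of record of this file): for an open subgroup `K` and a left-`K`-invariant
test function `f₁`, only finitely many blocks of the spectral expansion of `J(f₁ ⋆ f₂)` are non-zero. -/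
theorem finite_specBlock_support [Countable S.Gk] (K : Subgroup G) (hK : IsOpen (K : Set G))
    {τ : ℕ → Set (G → ℂ)} (hB : S.IsAdaptedONB τ φ n) (h₁ : IsTest f₁)
    (hf₁ : ∀ k ∈ K, ∀ g, f₁ (k * g) = f₁ g) : {m : ℕ | specBlock S χ χ' φ n f₁ f₂ m ≠ 0}.Finite := by
  refine (S.finite_biinvariant_support K hK hB).subset fun m hm => ?_
  exact S.exists_biinvariant_of_specBlock_ne_zero χ χ' φ n f₁ f₂ K hB h₁ hf₁ hm

/-- **the finite spectrum of a level**: a `Finset` carrying every non-zero block — plan-1's (S1b) `FiniteSpectrum`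
clause for a `K`-invariant test pair, as a theorem. -/
theorem exists_finset_specBlock_support [Countable S.Gk] (K : Subgroup G) (hK : IsOpen (K : Set G))
    {τ : ℕ → Set (G → ℂ)} (hB : S.IsAdaptedONB τ φ n) (h₁ : IsTest f₁)
    (hf₁ : ∀ k ∈ K, ∀ g, f₁ (k * g) = f₁ g) :
    ∃ s : Finset ℕ, ∀ m ∉ s, specBlock S χ χ' φ n f₁ f₂ m = 0 := by
  refine ⟨(S.finite_specBlock_support χ χ' φ n f₁ f₂ K hK hB h₁ hf₁).toFinset, fun m hm => ?_⟩
  by_contra hne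
  exact hm ((S.finite_specBlock_support χ χ' φ n f₁ f₂ K hK hB h₁ hf₁).mem_toFinset.mpr hne)

end Main

end Setting

end RTF

end Summit.Ventures.HodgeRepro.Tier4.Line1

end
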